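import Summits.QuantumFields.YangMills.Theorems.BalabanStepParabolic.Negative.ScalingLimitInRegion

/-!
# `BalabanStepParabolic` — negative-side support XVI: every small coupling is (almost) reached by deep orbits

Support file for crux `stmt-QuantumFields-9684` (`ParabolicTrajectory.BalabanStepParabolic`), extracted from the
standing disprover's work file `Cruxes/BalabanStepParabolic/Disproof.lean` §V (cycle 3); continuation of
`ScalingLimitInRegion.lean`. Tree objects only.

`forced_scaling_limit_of_region` forces a scaling limit of genuine Wilson data at every arrival coupling `t`
that in-region deep sequences REACH. This file shows, for EVERY inhabitant, that the reachable couplings are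
`c₁t³`-dense: deep Wilson orbits have strictly INCREASING couplings (`φ g y ≥ g + (b/2)g³` once the fibre has
decayed, `φ_lower_deep` / `deep_increment`), so the orbit of every small bare coupling `g < t` crosses the level
`t` inside the region, at a depth `≥ (1/g² − 1/t²)/(2c₁) → ∞` as `g → 0⁺`, landing in `[t, t + c₁t³]`
(`exists_crossing`, `crossing_spec`); extracting a subsequence with convergent arrival couplings gives
**`exists_reaching_sequence`**: for every cap `τ` below a threshold and every `t > 0` with `t + c₁t³ ≤ τ`
there are `t' ∈ [t, t + c₁t³]` and an in-region(`τ`) deep sequence with arrival couplings `→ t'`. Combined with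
`forced_scaling_limit_of_region`: (4c) forces, for every inhabitant, a scaling limit of the genuine dilated
plaquette correlators at a `c₁t³`-dense set of running couplings `t'` — the full physical content.
-/

namespace Summit.QuantumFields.YangMills.Theorems.BalabanStepParabolic.Negative

open scoped SchwartzMap
open MeasureTheory Filter Topology
open Literature.MathematicalPhysics.QuantumFieldTheory Literature.MathematicalPhysics.AQFT
open Literature.MathematicalPhysics.QuantumLattice

noncomputable section

variable {G : Type} [Group G] [TopologicalSpace G] [IsTopologicalGroup G] [CompactSpace G]
  [MeasurableSpace G] [BorelSpace G] {r : LatticeRep G} {M : ℕ} (S : BalabanBanachStep G r M)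

/-- **Deep points move UP in the coupling**: `φ g y ≥ g + (b/2) g³` whenever `C g ≤ b/4` and
`C ‖y‖ ≤ b/4` (from the basin remainder bound `|φ − (g + bg³)| ≤ C(g⁴ + g³‖y‖)`). [folklore] -/
theorem φ_lower_deep {g : ℝ} {y : S.E} (hg0 : 0 ≤ g) (hgδ : g ≤ S.δ) (hy : ‖y‖ ≤ S.R)
    (hg : S.C * g ≤ S.b / 4) (hyb : S.C * ‖y‖ ≤ S.b / 4) :
    g + S.b / 2 * g ^ 3 ≤ S.φ g y := by
  have habs : |g| ≤ S.δ := by rwa [abs_of_nonneg hg0]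
  have h := S.remainder_basin g y habs hy
  rw [abs_of_nonneg hg0] at h
  have hlow := (abs_le.1 h).1
  have hg3 : 0 ≤ g ^ 3 := by positivity
  -- φ ≥ g + b g³ - C g⁴ - C g³ ‖y‖ = g + g³ (b - C g - C ‖y‖) ≥ g + g³ b/2
  nlinarith [mul_le_mul_of_nonneg_left hg hg3, mul_le_mul_of_nonneg_left hyb hg3]

/-- **Orbit facts under a coupling cap.** If the Wilson orbit from `g ∈ (0, τ]` (`τ ≤ gₛ`, `g ≤ g₀`) has
couplings `≤ τ` up to depth `k`, then up to depth `k` its couplings are positive, its fibres are in the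
basin, and `1/g_i² ≥ 1/g² − 2c₁ i`. [folklore] -/
theorem orbit_of_cap {τ g : ℝ}
    (hτs : τ ≤ (min S.δ (min (Real.sqrt (1 / (2 * (S.b + S.C * (S.δ + S.R))))) (Real.sqrt ((1 - S.θ') * S.R / S.C)))))
    (hg0 : 0 < g) (hg₀ : g ≤ S.g₀) (k : ℕ)
    (hcap : ∀ i ≤ k, (S.F^[i] (g, S.yW g)).1 ≤ τ) :
    ∀ i ≤ k, 0 < (S.F^[i] (g, S.yW g)).1 ∧ ‖(S.F^[i] (g, S.yW g)).2‖ ≤ S.R ∧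
      1 / g ^ 2 - 2 * (S.b + S.C * (S.δ + S.R)) * i ≤ 1 / (S.F^[i] (g, S.yW g)).1 ^ 2 := by
  intro i hi
  induction i with
  | zero =>
    simp only [Function.iterate_zero, id_eq, CharP.cast_eq_zero, mul_zero, sub_zero, le_refl, and_true]
    exact ⟨hg0, S.norm_yW_le g ⟨hg0.le, hg₀⟩⟩
  | succ i ih =>
    obtain ⟨hpos, hy, hinv⟩ := ih (Nat.le_of_succ_le hi)
    set q := S.F^[i] (g, S.yW g) with hq
    have hstep : S.F^[i + 1] (g, S.yW g) = (S.φ q.1 q.2, S.Ψ q.1 q.2) := by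
      rw [Function.iterate_succ_apply', hq]; rfl
    have hqτ : q.1 ≤ τ := hcap i (Nat.le_of_succ_le hi)
    have hqs := hqτ.trans hτs
    have hqδ : q.1 ≤ S.δ := hqs.trans (gₛ_le_δ S)
    have habs : |q.1| ≤ S.δ := by rwa [abs_of_pos hpos]
    have hφ := abs_φ_sub_self_le S hpos.le hqδ hy
    have hc₁ := c₁_pos S
    have hq2 : (S.b + S.C * (S.δ + S.R)) * q.1 ^ 2 ≤ 1 / 2 := by
      calc (S.b + S.C * (S.δ + S.R)) * q.1 ^ 2 ≤ (S.b + S.C * (S.δ + S.R)) * (min S.δ (min (Real.sqrt (1 / (2 * (S.b + S.C * (S.δ + S.R))))) (Real.sqrt ((1 - S.θ') * S.R / S.C)))) ^ 2 := by gcongr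
        _ ≤ 1 / 2 := c₁_mul_gₛ_sq S
    have hlow : q.1 - (S.b + S.C * (S.δ + S.R)) * q.1 ^ 3 ≤ S.φ q.1 q.2 := by linarith [(abs_le.1 hφ).1]
    have hpos' : 0 < S.φ q.1 q.2 := by
      have : q.1 / 2 ≤ q.1 - (S.b + S.C * (S.δ + S.R)) * q.1 ^ 3 := by nlinarith
      linarith
    have hup : S.φ q.1 q.2 ≤ q.1 + (S.b + S.C * (S.δ + S.R)) * q.1 ^ 3 := by linarith [(abs_le.1 hφ).2]
    have hinv' := inv_sq_step hpos hpos' hc₁.le hup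
    have hy' : ‖S.Ψ q.1 q.2‖ ≤ S.R := by
      refine S.norm_Ψ_le_R habs hy ?_
      calc S.C * q.1 ^ 2 ≤ S.C * (min S.δ (min (Real.sqrt (1 / (2 * (S.b + S.C * (S.δ + S.R))))) (Real.sqrt ((1 - S.θ') * S.R / S.C)))) ^ 2 := by
            have := S.C_pos; gcongr
        _ ≤ (1 - S.θ') * S.R := C_mul_gₛ_sq S
    rw [hstep]
    refine ⟨hpos', hy', ?_⟩
    push_cast
    linarith

/-- **Increment thresholds.** A cap `τ₁ ∈ (0, min gₛ g₀]` with `C τ₁ ≤ b/4` and `C · Cτ₁²/(1−θ') ≤ b/8`,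
and a depth `i₁` with `C θ'^{i₁} R ≤ b/8`. [folklore] -/
theorem exists_τ₁ : ∃ τ₁ : ℝ, 0 < τ₁ ∧
    τ₁ ≤ (min S.δ (min (Real.sqrt (1 / (2 * (S.b + S.C * (S.δ + S.R))))) (Real.sqrt ((1 - S.θ') * S.R / S.C)))) ∧
    τ₁ ≤ S.g₀ ∧ S.C * τ₁ ≤ S.b / 4 ∧ S.C * (S.C * τ₁ ^ 2 / (1 - S.θ')) ≤ S.b / 8 := by
  have hb := S.b_pos
  have hcont1 : Continuous fun τ : ℝ => S.C * τ := by fun_prop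
  have hcont2 : Continuous fun τ : ℝ => S.C * (S.C * τ ^ 2 / (1 - S.θ')) := by fun_prop
  have hev1 : ∀ᶠ τ in 𝓝 (0 : ℝ), S.C * τ < S.b / 4 :=
    hcont1.continuousAt.eventually_lt continuousAt_const (by simp; positivity)
  have hev2 : ∀ᶠ τ in 𝓝 (0 : ℝ), S.C * (S.C * τ ^ 2 / (1 - S.θ')) < S.b / 8 :=
    hcont2.continuousAt.eventually_lt continuousAt_const (by simp; positivity)
  have hev3 : ∀ᶠ τ in 𝓝[>] (0 : ℝ), τ ∈ Set.Ioo 0 (min (min S.δ (min (Real.sqrt (1 / (2 * (S.b + S.C * (S.δ + S.R))))) (Real.sqrt ((1 - S.θ') * S.R / S.C)))) S.g₀) :=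
    Ioo_mem_nhdsGT (lt_min (gₛ_pos S) S.g₀_pos)
  obtain ⟨τ₁, ⟨h1, h2⟩, h3⟩ :=
    (((hev1.and hev2).filter_mono nhdsWithin_le_nhds).and hev3).exists
  exact ⟨τ₁, h3.1, h3.2.le.trans (min_le_left _ _), h3.2.le.trans (min_le_right _ _), h1.le, h2.le⟩

/-- The depth after which the fibre transient `θ'^i R` is below `b/(8C)`. [folklore] -/
theorem exists_i₁ : ∃ i₁ : ℕ, S.C * (S.θ' ^ i₁ * S.R) ≤ S.b / 8 := by
  have h := ((tendsto_pow_atTop_nhds_zero_of_lt_one S.θ'_nonneg S.θ'_lt_one).mul_const S.R).const_mul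
    S.C
  rw [zero_mul, mul_zero] at h
  exact (h.eventually (eventually_le_nhds (by have := S.b_pos; positivity))).exists

/-- **Deep couplings increase strictly.** Under a cap `τ ≤ τ₁` up to depth `k`, at every depth
`j ∈ [i₁, k]` the next coupling is `≥ g_j + (b/2) g_j³`. [folklore] -/
theorem deep_increment {τ₁ τ g : ℝ}
    (hτ₁s : τ₁ ≤ (min S.δ (min (Real.sqrt (1 / (2 * (S.b + S.C * (S.δ + S.R))))) (Real.sqrt ((1 - S.θ') * S.R / S.C)))))
    (hCτ₁ : S.C * τ₁ ≤ S.b / 4) (hCτ₁2 : S.C * (S.C * τ₁ ^ 2 / (1 - S.θ')) ≤ S.b / 8)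
    {i₁ : ℕ} (hi₁ : S.C * (S.θ' ^ i₁ * S.R) ≤ S.b / 8) (hττ₁ : τ ≤ τ₁)
    (hg0 : 0 < g) (hgτ : g ≤ τ) (hg₀ : g ≤ S.g₀) (k : ℕ) (hcap : ∀ i ≤ k, (S.F^[i] (g, S.yW g)).1 ≤ τ)
    {j : ℕ} (hjk : j ≤ k) (hij : i₁ ≤ j) :
    (S.F^[j] (g, S.yW g)).1 + S.b / 2 * (S.F^[j] (g, S.yW g)).1 ^ 3 ≤ (S.F^[j + 1] (g, S.yW g)).1 := by
  have hτs := hττ₁.trans hτ₁s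
  have hτδ : τ ≤ S.δ := hτs.trans (gₛ_le_δ S)
  have horb := orbit_of_cap S hτs hg0 hg₀ k hcap
  set q := S.F^[j] (g, S.yW g) with hq
  have hstep : S.F^[j + 1] (g, S.yW g) = (S.φ q.1 q.2, S.Ψ q.1 q.2) := by
    rw [Function.iterate_succ_apply', hq]; rfl
  rw [hstep]
  obtain ⟨hpos, hyR, -⟩ := horb j hjk
  have hqτ : q.1 ≤ τ := hcap j hjk
  -- fibre decay up to depth j
  have hdec := fibre_decay S hτδ (g, S.yW g) j (fun i hi =>
    ⟨⟨(horb i (hi.le.trans hjk)).1.le, hcap i (hi.le.trans hjk)⟩, (horb i (hi.le.trans hjk)).2.1⟩)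
  rw [← hq] at hdec
  have hθ'0 := S.θ'_nonneg
  have hθ'1 : 0 < 1 - S.θ' := by linarith [S.θ'_lt_one]
  have hC := S.C_pos.le
  have hyW : ‖S.yW g‖ ≤ S.R := S.norm_yW_le g ⟨hg0.le, hg₀⟩
  have hτ0 : 0 ≤ τ := hg0.le.trans hgτ
  have hpow : S.θ' ^ j ≤ S.θ' ^ i₁ := pow_le_pow_of_le_one hθ'0 S.θ'_lt_one.le hij
  have hy4 : S.C * ‖q.2‖ ≤ S.b / 4 := by
    have h1 : ‖q.2‖ ≤ S.θ' ^ i₁ * S.R + S.C * τ₁ ^ 2 / (1 - S.θ') := by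
      calc ‖q.2‖ ≤ S.θ' ^ j * ‖(g, S.yW g).2‖ + S.C * τ ^ 2 / (1 - S.θ') := hdec
        _ ≤ S.θ' ^ i₁ * S.R + S.C * τ₁ ^ 2 / (1 - S.θ') := by
            gcongr
    calc S.C * ‖q.2‖ ≤ S.C * (S.θ' ^ i₁ * S.R + S.C * τ₁ ^ 2 / (1 - S.θ')) :=
          mul_le_mul_of_nonneg_left h1 hC
      _ = S.C * (S.θ' ^ i₁ * S.R) + S.C * (S.C * τ₁ ^ 2 / (1 - S.θ')) := by ring
      _ ≤ S.b / 8 + S.b / 8 := add_le_add hi₁ hCτ₁2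
      _ = S.b / 4 := by ring
  have hg4 : S.C * q.1 ≤ S.b / 4 :=
    (mul_le_mul_of_nonneg_left (hqτ.trans hττ₁) hC).trans hCτ₁
  exact φ_lower_deep S hpos.le (hqτ.trans hτδ) hyR hg4 hy4

/-- **Crossing exists.** Under the increment thresholds, the orbit of a Wilson point `0 < g < t`
(`t ≤ τ ≤ τ₁`) reaches the level `t`: some `g_k ≥ t`. [folklore] -/
theorem exists_crossing {τ₁ τ g t : ℝ}
    (hτ₁s : τ₁ ≤ (min S.δ (min (Real.sqrt (1 / (2 * (S.b + S.C * (S.δ + S.R))))) (Real.sqrt ((1 - S.θ') * S.R / S.C)))))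
    (hCτ₁ : S.C * τ₁ ≤ S.b / 4) (hCτ₁2 : S.C * (S.C * τ₁ ^ 2 / (1 - S.θ')) ≤ S.b / 8)
    {i₁ : ℕ} (hi₁ : S.C * (S.θ' ^ i₁ * S.R) ≤ S.b / 8) (hττ₁ : τ ≤ τ₁)
    (hg0 : 0 < g) (hg₀ : g ≤ S.g₀) (htτ : t ≤ τ) (hgt : g < t) :
    ∃ k : ℕ, t ≤ (S.F^[k] (g, S.yW g)).1 := by
  by_contra hcon
  push Not at hcon
  have hgτ : g ≤ τ := hgt.le.trans htτ
  have hcap : ∀ k, ∀ i ≤ k, (S.F^[i] (g, S.yW g)).1 ≤ τ := fun k i _ => (hcon i).le.trans htτ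
  have hτs := hττ₁.trans hτ₁s
  -- positivity everywhere
  have hpos : ∀ i, 0 < (S.F^[i] (g, S.yW g)).1 := fun i => (orbit_of_cap S hτs hg0 hg₀ i (hcap i) i le_rfl).1
  -- increments from depth i₁ on
  have hinc : ∀ j, i₁ ≤ j → (S.F^[j] (g, S.yW g)).1 + S.b / 2 * (S.F^[j] (g, S.yW g)).1 ^ 3 ≤
      (S.F^[j + 1] (g, S.yW g)).1 :=
    fun j hij => deep_increment S hτ₁s hCτ₁ hCτ₁2 hi₁ hττ₁ hg0 hgτ hg₀ j (hcap j) le_rfl hij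
  set m := (S.F^[i₁] (g, S.yW g)).1 with hm
  have hm0 : 0 < m := hpos i₁
  have hb := S.b_pos
  -- monotone lower bound: g_{i₁ + n} ≥ m + n (b/2) m³
  have hmono : ∀ n : ℕ, m + n * (S.b / 2 * m ^ 3) ≤ (S.F^[i₁ + n] (g, S.yW g)).1 := by
    intro n
    induction n with
    | zero => simp [hm]
    | succ n ih =>
      have h1 := hinc (i₁ + n) (Nat.le_add_right _ _)
      rw [show i₁ + (n + 1) = i₁ + n + 1 by ring]
      have hge : m ≤ (S.F^[i₁ + n] (g, S.yW g)).1 := by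
        have : (0 : ℝ) ≤ n * (S.b / 2 * m ^ 3) := by positivity
        linarith
      have hcube : m ^ 3 ≤ (S.F^[i₁ + n] (g, S.yW g)).1 ^ 3 := pow_le_pow_left₀ hm0.le hge 3
      push_cast
      nlinarith
  -- Archimedes
  obtain ⟨n, hn⟩ := exists_nat_gt ((t - m) / (S.b / 2 * m ^ 3))
  have hstep : 0 < S.b / 2 * m ^ 3 := by positivity
  have h1 : t - m < n * (S.b / 2 * m ^ 3) := by
    rw [div_lt_iff₀ hstep] at hn; linarith
  have h2 := hmono n
  have h3 := hcon (i₁ + n)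
  linarith

open Classical in
/-- **Crossing data.** With `k` the FIRST depth at which the orbit of `g < t` reaches level `t`
(`t + c₁t³ ≤ τ ≤ τ₁`): the orbit has couplings in `[0, τ]` and fibres in the basin up to depth `k`, its
arrival coupling lies in `[t, t + c₁t³]`, and the depth satisfies `2c₁k ≥ 1/g² − 1/t²`. [folklore] -/
theorem crossing_spec {τ₁ τ g t : ℝ}
    (hτ₁s : τ₁ ≤ (min S.δ (min (Real.sqrt (1 / (2 * (S.b + S.C * (S.δ + S.R))))) (Real.sqrt ((1 - S.θ') * S.R / S.C)))))
    (hCτ₁ : S.C * τ₁ ≤ S.b / 4) (hCτ₁2 : S.C * (S.C * τ₁ ^ 2 / (1 - S.θ')) ≤ S.b / 8)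
    {i₁ : ℕ} (hi₁ : S.C * (S.θ' ^ i₁ * S.R) ≤ S.b / 8) (hττ₁ : τ ≤ τ₁)
    (hg0 : 0 < g) (hg₀ : g ≤ S.g₀) (ht0 : 0 < t) (htτ : t + (S.b + S.C * (S.δ + S.R)) * t ^ 3 ≤ τ)
    (hgt : g < t) :
    ∃ k : ℕ, (∀ i ≤ k, (S.F^[i] (g, S.yW g)).1 ∈ Set.Icc 0 τ ∧ ‖(S.F^[i] (g, S.yW g)).2‖ ≤ S.R) ∧
      (S.F^[k] (g, S.yW g)).1 ∈ Set.Icc t (t + (S.b + S.C * (S.δ + S.R)) * t ^ 3) ∧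
      1 / g ^ 2 - 1 / t ^ 2 ≤ 2 * (S.b + S.C * (S.δ + S.R)) * k := by
  have hc₁ := c₁_pos S
  have htτ' : t ≤ τ := le_trans (le_add_of_nonneg_right (by positivity)) htτ
  have hex := exists_crossing S hτ₁s hCτ₁ hCτ₁2 hi₁ hττ₁ hg0 hg₀ htτ' hgt
  set k := Nat.find hex with hk
  have hkspec : t ≤ (S.F^[k] (g, S.yW g)).1 := Nat.find_spec hex
  have hkmin : ∀ i < k, (S.F^[i] (g, S.yW g)).1 < t := fun i hi => lt_of_not_ge (Nat.find_min hex hi)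
  have hgτ : g ≤ τ := hgt.le.trans htτ'
  have hτs := hττ₁.trans hτ₁s
  have hτδ : τ ≤ S.δ := hτs.trans (gₛ_le_δ S)
  -- k ≥ 1
  have hk1 : k ≠ 0 := by
    intro h0
    rw [h0] at hkspec
    simp only [Function.iterate_zero, id_eq] at hkspec
    linarith
  obtain ⟨k', hk'⟩ := Nat.exists_eq_succ_of_ne_zero hk1
  -- cap up to k' = k - 1
  have hcap' : ∀ i ≤ k', (S.F^[i] (g, S.yW g)).1 ≤ τ :=
    fun i hi => (hkmin i (by omega)).le.trans htτ'
  have horb' := orbit_of_cap S hτs hg0 hg₀ k' hcap'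
  -- the arrival coupling
  set q := S.F^[k'] (g, S.yW g) with hq
  have hstep : S.F^[k] (g, S.yW g) = (S.φ q.1 q.2, S.Ψ q.1 q.2) := by
    rw [hk', Function.iterate_succ_apply', hq]; rfl
  obtain ⟨hqpos, hqR, hqinv⟩ := horb' k' le_rfl
  have hqt : q.1 < t := hkmin k' (by omega)
  have hφ := abs_φ_sub_self_le S hqpos.le ((hqt.le.trans htτ').trans hτδ) hqR
  have harr_le : (S.F^[k] (g, S.yW g)).1 ≤ t + (S.b + S.C * (S.δ + S.R)) * t ^ 3 := by
    rw [hstep]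
    have h1 : S.φ q.1 q.2 ≤ q.1 + (S.b + S.C * (S.δ + S.R)) * q.1 ^ 3 := by linarith [(abs_le.1 hφ).2]
    have h2 : q.1 ^ 3 ≤ t ^ 3 := pow_le_pow_left₀ hqpos.le hqt.le 3
    nlinarith
  -- cap up to k
  have hcap : ∀ i ≤ k, (S.F^[i] (g, S.yW g)).1 ≤ τ := by
    intro i hi
    rcases Nat.lt_or_ge i k with h | h
    · exact (hkmin i h).le.trans htτ'
    · have : i = k := le_antisymm hi h
      rw [this]; exact harr_le.trans htτ
  have horb := orbit_of_cap S hτs hg0 hg₀ k hcap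
  refine ⟨k, fun i hi => ⟨⟨(horb i hi).1.le, hcap i hi⟩, (horb i hi).2.1⟩, ⟨hkspec, harr_le⟩, ?_⟩
  -- depth lower bound from the inverse-square bound at depth k
  have hinv := (horb k le_rfl).2.2
  have hpk := (horb k le_rfl).1
  have h1 : 1 / (S.F^[k] (g, S.yW g)).1 ^ 2 ≤ 1 / t ^ 2 := by
    apply one_div_le_one_div_of_le (by positivity)
    exact pow_le_pow_left₀ ht0.le hkspec 2
  linarith

/-- **REACHING SEQUENCES EXIST at every small level (any inhabitant).** There is a cap threshold `τ₁ > 0`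
(`τ₁ ≤ min gₛ g₀`) such that for every cap `τ ∈ (0, τ₁]` and every level `t > 0` with `t + c₁t³ ≤ τ` there
are `t' ∈ [t, t + c₁t³]` and an in-region(`τ`) deep sequence of Wilson orbit points — bare couplings
`g_j → 0⁺`, depths `k_j → ∞`, couplings in `[0, τ]` and fibres in the basin up to depth `k_j` — whose
arrival couplings converge to `t'`. With `forced_scaling_limit_of_region` (cap `min τ₁ τmax`): for every
inhabitant and odd `M`, (4c) forces a scaling limit of the genuine dilated Wilson data at a `c₁t³`-DENSE
set of running couplings `t'`. [folklore] -/
theorem exists_reaching_sequence :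
    ∃ τ₁ : ℝ, 0 < τ₁ ∧
      τ₁ ≤ (min S.δ (min (Real.sqrt (1 / (2 * (S.b + S.C * (S.δ + S.R))))) (Real.sqrt ((1 - S.θ') * S.R / S.C)))) ∧
      τ₁ ≤ S.g₀ ∧
    ∀ τ : ℝ, 0 < τ → τ ≤ τ₁ → ∀ t : ℝ, 0 < t → t + (S.b + S.C * (S.δ + S.R)) * t ^ 3 ≤ τ →
      ∃ t' ∈ Set.Icc t (t + (S.b + S.C * (S.δ + S.R)) * t ^ 3),
      ∃ (g : ℕ → ℝ) (k : ℕ → ℕ), (∀ j, g j ∈ Set.Ioc 0 S.g₀) ∧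
        (∀ j, ∀ i ≤ k j, (S.F^[i] (g j, S.yW (g j))).1 ∈ Set.Icc 0 τ ∧
          ‖(S.F^[i] (g j, S.yW (g j))).2‖ ≤ S.R) ∧
        Tendsto k atTop atTop ∧ Tendsto (fun j => (S.F^[k j] (g j, S.yW (g j))).1) atTop (𝓝 t') := by
  classical
  obtain ⟨τ₁, hτ₁0, hτ₁s, hτ₁g₀, hCτ₁, hCτ₁2⟩ := exists_τ₁ S
  obtain ⟨i₁, hi₁⟩ := exists_i₁ S
  refine ⟨τ₁, hτ₁0, hτ₁s, hτ₁g₀, fun τ hτ0 hττ₁ t ht0 htτ => ?_⟩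
  have hc₁ := c₁_pos S
  have htτ' : t ≤ τ := le_trans (le_add_of_nonneg_right (by positivity)) htτ
  -- bare couplings g_j = g_b/(j+2) with g_b = min t g₀ (note t ≤ τ ≤ τ₁ ≤ g₀ is not assumed)
  set gb : ℝ := min t S.g₀ with hgb
  have hgb0 : 0 < gb := lt_min ht0 S.g₀_pos
  set g : ℕ → ℝ := fun j => gb / (j + 2) with hg
  have hgpos : ∀ j, 0 < g j := fun j => by rw [hg]; positivity
  have hglt : ∀ j, g j < t := fun j => by
    rw [hg]
    have h2 : (1 : ℝ) < (j : ℝ) + 2 := by have := (Nat.cast_nonneg j : (0 : ℝ) ≤ j); linarith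
    calc gb / (j + 2) < gb / 1 := div_lt_div_of_pos_left hgb0 one_pos h2
      _ = gb := div_one _
      _ ≤ t := min_le_left _ _
  have hgg₀ : ∀ j, g j ≤ S.g₀ := fun j => by
    rw [hg]
    have h2 : (1 : ℝ) ≤ (j : ℝ) + 2 := by have := (Nat.cast_nonneg j : (0 : ℝ) ≤ j); linarith
    calc gb / (j + 2) ≤ gb / 1 := div_le_div_of_nonneg_left hgb0.le one_pos h2
      _ = gb := div_one _
      _ ≤ S.g₀ := min_le_right _ _
  -- crossing depths
  have hcross : ∀ j, ∃ k : ℕ,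
      (∀ i ≤ k, (S.F^[i] (g j, S.yW (g j))).1 ∈ Set.Icc 0 τ ∧ ‖(S.F^[i] (g j, S.yW (g j))).2‖ ≤ S.R) ∧
      (S.F^[k] (g j, S.yW (g j))).1 ∈ Set.Icc t (t + (S.b + S.C * (S.δ + S.R)) * t ^ 3) ∧
      1 / (g j) ^ 2 - 1 / t ^ 2 ≤ 2 * (S.b + S.C * (S.δ + S.R)) * k :=
    fun j => crossing_spec S hτ₁s hCτ₁ hCτ₁2 hi₁ hττ₁ (hgpos j) (hgg₀ j) ht0 htτ (hglt j)
  choose k hkreg hkarr hkdepth using hcross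
  -- depths → ∞
  have hkinf : Tendsto k atTop atTop := by
    have h1 : Tendsto (fun j : ℕ => (1 / (g j) ^ 2 - 1 / t ^ 2) / (2 * (S.b + S.C * (S.δ + S.R)))) atTop atTop := by
      have e : ∀ j : ℕ, (1 / (g j) ^ 2 - 1 / t ^ 2) / (2 * (S.b + S.C * (S.δ + S.R))) =
          ((j : ℝ) + 2) ^ 2 * (1 / (gb ^ 2 * (2 * (S.b + S.C * (S.δ + S.R))))) +
            (-(1 / t ^ 2) / (2 * (S.b + S.C * (S.δ + S.R)))) := by
        intro j; rw [hg]; field_simp; ring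
      simp_rw [e]
      refine tendsto_atTop_add_const_right _ _ (Tendsto.atTop_mul_const (by positivity) ?_)
      exact (tendsto_pow_atTop two_ne_zero).comp
        (tendsto_atTop_add_const_right _ _ tendsto_natCast_atTop_atTop)
    have h2 : Tendsto (fun j => (k j : ℝ)) atTop atTop := by
      refine tendsto_atTop_mono (fun j => ?_) h1
      rw [div_le_iff₀ (by positivity)]
      linarith [hkdepth j]
    exact tendsto_natCast_atTop_iff.1 h2
  -- arrival couplings in a compact interval: extract a convergent subsequence
  obtain ⟨t', ht', ψ, hψ, hlim⟩ := isCompact_Icc.tendsto_subseq (fun j => hkarr j)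
  exact ⟨t', ht', g ∘ ψ, k ∘ ψ, fun j => ⟨hgpos _, hgg₀ _⟩, fun j => hkreg _,
    hkinf.comp hψ.tendsto_atTop, hlim⟩

end

end Summit.QuantumFields.YangMills.Theorems.BalabanStepParabolic.Negative
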